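import Summits.QuantumFields.BalabanUV.T4Continuum.Spine.NE1p.DressedSmallFieldComponentInnerMu
import Summits.QuantumFields.BalabanUV.T4Continuum.Spine.NE1p.DressedSmallFieldComponentInnerNestedTori

/-!
# T⁴ programme, spine estimate NE1′ (node O3b/H2) — THE μ-TWIN OF S51: ROAD P1's SOURCE-PENCIL (B3-count) CHAIN ON pv22's NESTED
# TORI WITH EVERY GEOMETRIC BINDER SUPPLIED — N0x PART 2's components μ-END (generic inner data, `hinner` displayed) and the owner's N0z
# §2 ∕ §3 (N0u's inner labels, `hinner` SUPPLIED by S41.2) fired ON `tsys 4 (L·N′)` (scale k) ⊂ `tsys 4 N′` (scale k+1) with N0u's link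
# by `link_torus` (`c₃₂ = 5`), N0v's link by `link_torus'` (`c′ = 5`), closure `tclosureDom`, transfer `ineq236With_torus`, anchor at the
# canonical cell (S51 §1) — NO geometry hypothesis, NO link binder, NO selector; [Balaban1988RGII] pp. 17–20 KIND, μ-extension UNPRINTED

Cell `pub-balaban`, sub-cell `t4`, BINDER-OWNERS row NE1′ (owner lineage t4-ne1p-p1, road P1 «RG-trajectory comparison … μ-uniformity
through the printed small-field bounds»); crew seat `b2b-balaban-t4-ne1p-formalise-leaf-01` (LEAF PROVER 01, generation 15); crew S-row
S⟨next⟩ ∕ DAG N29⟨next⟩ «N0z ∘ S51's dictionary» (own-initiative, the g14 HANDOFF's follow-up; the owner g31's word `CLAIMS.log`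
2026-08-20 l.21941 «a later crew torus face of N0z composes with S51's dictionary by name»; INTENT + PROTOTYPE + STAGED `CLAIMS.log`
l.22959 (22:58:48Z); the typer gen 8 labels it, R-T140).  ADDITIVE — imports the owner's N0z `Spine/NE1p/DressedSmallFieldComponentInnerMu` (p238352 ✓✓; →
N0x PART 2 `DressedSmallFieldLabelCountsMu` p236238 ✓✓, S41 PART 2) and this lineage's S51 `Spine/NE1p/DressedSmallFieldComponentInnerNestedTori`
(p238434 ✓✓; → S41.2, S44, S40.1, pv22's [cite]-tagged `TreeLengthTorusGeometry236`) ONLY; THEOREMS ONLY (0 `def`, 0 `def … : Prop`,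
0 cite); nothing of N0s–N0z ∕ S41 ∕ S44 ∕ S40 ∕ S51 ∕ S24 ∕ N0o ∕ pv22 is restated — `muPart_locE_le_of_coresAt_pencil_components` (N0x
P2), `muPart_locE_le_of_coresAt_pencil_components_inner` ∕ `…_componentSets_inner` (N0z §2 ∕ §3), `exists_mem_anchor_choose` ∕
`card_anchor_choose_le` (S51 §1), `link_torus` ∕ `link_torus'` (S40.1), `ineq236With_torus` (pv22), `torus_consts` (N0o), `K₀_four` (S24)
are used BY NAME, ONCE per END.

WHY THIS FILE.  S51 put THE WHOLE (B3-count) chain — 𝐃-step (N0s), Y₀∕P-step (N0u), components∕{Z′_i}-step (N0w ∘ N0v), Z∖Z′₀-step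
(N0v) — on pv22's CONSTRUCTED nested tori as ONE kernel implication with NO geometric item left displayed, for the ATTACHED PART
(table pencil `h₀ + σ • w`).  Road P1's sentence is about the SOURCE: the owner's N0x P2 ∕ N0z typed the μ-twins (source pencil
`h₀ + s • v`, `‖s‖ < μ₁`; «μ enters (B3) through the amplitude ALONE») over ABSTRACT geometries `D`∕`G`∕`Gk` with N0u's link `hlinkk`,
N0w's `cl`∕`anc`∕`hanchor`∕`hA'`∕`htransfer` and N0v's `hlink` DISPLAYED.  This file is the junction the owner named (l.21941):
* §1 **`muPart_locE_le_of_coresAt_pencil_components_nestedTori`** — N0x P2's `muPart_locE_le_of_coresAt_pencil_components` (generic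
  inner data `I`∕`m`∕`hm0`, inner-count SHAPE `hinner` DISPLAYED at free `c₀`, `R₀`) — S44's μ-twin with links, anchor, selector GONE;
* §2 **`muPart_locE_le_of_coresAt_pencil_components_inner_nestedTori`** — N0z §2 (ONE anchored component per member carrying one of
  N0u's admissible labels `⟨W, (𝐃, P)⟩` WRITTEN OUT; `hinner` SUPPLIED inside N0z by S41.2 §1) — the μ-twin of S51's single-component END;
* §3 **`muPart_locE_le_of_coresAt_pencil_componentSets_inner_nestedTori`** — N0z §3 (a NONEMPTY SET of such components per member,
  print p. 19's n ≥ 1 components determining `Z′_i`, KIND) — the μ-twin of S51's set-valued END.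
In all three the source (`μ₁`, `μ₀`, `sμ`, `v`) occurs ONLY in `hH`, `hact`, `hAmp` and the conclusion — in no count binder and now
in NO geometric binder either.

PRINTED LOCI (TYPE ∕ CONTEXT only — [Balaban1988RGII] = T. Bałaban, Renormalization group approach to lattice gauge field theories. II,
Commun. Math. Phys. 116 (1988) 1–22, pp. 17–20, quoted VERBATIM in the imported owner ∕ S44 ∕ S40 ∕ S51 headers from the renders
`b2b-balaban-ref1/pages/1988-cmp116-rg-II-cluster/…-p017…p020-x2.png` (t4-ref2 pass 86 C-t4r2-407); no new render reading is claimed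
here): p. 18 (2.27), (2.29), (2.32); p. 19 (2.35)∕(2.36) «For each Z′_i we sum over all possible components of Z₀ determining this Z′_i»,
«A sum over n components is estimated by a product of n sums»; p. 20 (2.37), C₃, Lemma 3 (2.38).  The μ-extension (observable-attached
table, source pencil) is the cell's, UNPRINTED ([Balaban1989LargeFieldII] p. 356 defers observables).  Nothing here is used as a fact
about Bałaban's densities.
WHAT STAYS DISPLAYED (binders, by name; NOTHING instantiated on Bałaban's densities): the room, operator conditions, class radii (source
radius `μ₁‖v‖` in `hH`); (B1b)'s residue `terms`∕`emb`∕`hscale`∕`hact` and `hadm` ((B1b)∕(2.35) READING); §1's inner-count SHAPE `hinner`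
(letters `m`∕`hm0`∕`c₀`∕`R₀`; (2.28)∕(2.33) KIND, NOT asserted); N0u's `bondsOf`∕`hb₀` and `δ κ α₆ R_k b₀ s t` (§2∕§3); the uncovered-cube
weight `vW` (S51's `v` — here `v` is the source direction, as in N0z); (B3-amp) `hAmp` — p. 18's clause KIND at `C₃(E₀ + D₀)` along the
source pencil, NOT asserted; the located clauses and rate bookkeeping (`c₀ = 64u_k − 5R_k`, `R₀ = R_k − 64u_k`, `u_k := e^{5R_k}·s·e^{b₀t}`
in §2∕§3), `0 < μ₀ < μ₁`, `‖sμ‖ ≤ μ₀`, `3 ≤ L` — (B5)-KIND bookkeeping whose standing against print's δ, κ, κ₁, α₆, L, M is NOT asserted.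
WHAT IT SAYS FOR THE WALL (owner's reading, wall v1.8 of record, T4-DAG v48 §6 NE1 — v49 carries it verbatim; nothing re-labelled):
«μ enters (B3) through the amplitude alone» holds for THE WHOLE (B3-count) on pv22's nested tori with links ∕ (2.36) transfer ∕ anchor ∕
closure KERNEL (S40.1 ∕ pv22's [cite]-tagged substitute of the unproved printed (2.36), G-B13-09R ∕ S51 §1); what remains is READING
(`hadm`; `tsys`∕`torusTreeLen`∕`tclosureDom` as Bałaban's 𝐃_k ⊂ 𝐃_{k+1} ∕ d_k ∕ Z′ — pv22's D-pv22.3, asserted nowhere), (B3-amp) `hAmp`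
and (B5)-KIND arithmetic.  NOTHING of (B3) discharged on Bałaban's (2.14) densities; 0 binders instantiated on Bałaban's densities; no
wall item moves; wall v1.8 (T4-DAG v48) — words, not kind — does NOT move; R-t4r2-Q2 NOT met thereby; NE1′ ⇐ the named binders — ONE
label NEW ∕ NOT PRINTED ∕ NOT PROVED; spine PROVED 0∕9; count 9 unchanged.
HONEST FRAMING.  By-name composition of LANDED kernel theorems over binder SHAPES; the cores ∕ labels are the cell's typed FORMAT of
(2.14) and of the resummation index, NOT Bałaban's functions; the located numerals are pv22's PROVED constants; print's ½L, (L+2)⁴ and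
(2.32)'s 4 are TYPE∕CONTEXT — ℓ = L∕a236 L, 3⁴·L⁴ and 5 are the tree's objects; ABSOLUTE RULE honoured — nothing internally minted is
cited, [folklore] tags on kernel theorems only.  Rung (B)+1 on ONE finite four-torus of fixed physical size — NOT infinite volume, NOT
a mass gap, NOT OS on ℝ⁴, NOT Clay.  HONEST DEPENDENCY: continuum YM on T⁴ ⇐ BetaPertH ∧ nine spine estimates (0/9 proved); BetaPertH
⇐ (D1) ∧ (D4) ∧ CAP+tail; G-an2-4 gates asym, D1 and NE2/3/4.
-/

noncomputable section

namespace Summit.QuantumFields.BalabanUV.T4Continuum.NE1p.DressedSmallFieldComponentInnerMuNestedTori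

open Metric Set Complex MeasureTheory
open scoped BigOperators
open Literature.MathematicalPhysics.QuantumFieldTheory.Balaban1983to89
open Literature.MathematicalPhysics.QuantumFieldTheory.Balaban1983to89.B13ScaleTransfer (Pt block coarse)
open Literature.MathematicalPhysics.QuantumFieldTheory.Balaban1983to89.B13FamilySum (coveringFamilies)
open Literature.MathematicalPhysics.QuantumFieldTheory.Balaban1983to89.T4OutputRate (Carriers)
open Literature.MathematicalPhysics.QuantumFieldTheory.Balaban1983to89.B13Resummation (locE Geometry)
open Literature.MathematicalPhysics.QuantumFieldTheory.Balaban1983to89.TreeLengthTorus (TPt proj natLift tsys TDom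
  torusTreeLen)
open Literature.MathematicalPhysics.QuantumFieldTheory.Balaban1983to89.TreeLengthTorusGeometry (TTouch tgeometry)
open Literature.MathematicalPhysics.QuantumFieldTheory.Balaban1983to89.TreeLengthTorusTransfer (tclosureDom)
open Literature.MathematicalPhysics.QuantumFieldTheory.Balaban1983to89.TreeLengthTorusGeometry236 (ineq236With_torus)
open Literature.MathematicalPhysics.QuantumFieldTheory.Balaban1983to89.B12TreeDecay (K₀)
open Literature.MathematicalPhysics.QuantumFieldTheory.Balaban1983to89.B13Geometry236 (a236)
open Summit.QuantumFields.BalabanUV.T4Continuum.B13HistMeasurable (MeasPotFrame B13HistM)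
open Summit.QuantumFields.BalabanUV.T4Continuum.B13TermParamGaussianBi (BiCore)
open Summit.QuantumFields.BalabanUV.T4Continuum.NE1p.DressedSmallFieldGeometry (torus_consts)
open Summit.QuantumFields.BalabanUV.T4Continuum.NE1p.DressedSmallFieldGeometryFaces (K₀_four)
open Summit.QuantumFields.BalabanUV.T4Continuum.NE1p.DressedSmallFieldInnerLink (link_torus link_torus')
open Summit.QuantumFields.BalabanUV.T4Continuum.NE1p.DressedSmallFieldComponentInnerNestedTori (exists_mem_anchor_choose
  card_anchor_choose_le)
open Summit.QuantumFields.BalabanUV.T4Continuum.NE1p.DressedSmallFieldLabelCountsMu (muPart_locE_le_of_coresAt_pencil_components)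
open Summit.QuantumFields.BalabanUV.T4Continuum.NE1p.DressedSmallFieldComponentInnerMu
  (muPart_locE_le_of_coresAt_pencil_components_inner muPart_locE_le_of_coresAt_pencil_componentSets_inner)

variable {L N' : ℕ} [NeZero L] [NeZero N'] {C : Carriers} {P : MeasPotFrame C} {Op : Type*} [NormedAddCommGroup Op]
  [NormedSpace ℂ Op] {Bnd : Type} [DecidableEq Bnd]

/-! ## §1 GENERIC INNER DATA (`hinner` DISPLAYED): N0x PART 2's components μ-END on the nested tori, links ∕ closure ∕ transfer ∕ anchor GONE -/

section Generic

variable {ι₀ : Type}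
  {𝒴 : ℕ → (Σ _ : Finset (TPt 4 N'), Σ F : Finset (tsys 4 N').Dom, ∀ Z ∈ F, (Σ _ : (tsys 4 (L * N')).Dom, ι₀)) → Type*}
  {dom : ∀ k i, 𝒴 k i → C.Dom}
  {β : ℕ → (Σ _ : Finset (TPt 4 N'), Σ F : Finset (tsys 4 N').Dom, ∀ Z ∈ F, (Σ _ : (tsys 4 (L * N')).Dom, ι₀)) → Type*}
  [∀ k i, MeasurableSpace (β k i)]
  {α : ℕ → (Σ _ : Finset (TPt 4 N'), Σ F : Finset (tsys 4 N').Dom, ∀ Z ∈ F, (Σ _ : (tsys 4 (L * N')).Dom, ι₀)) → Type*}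
  [∀ k i, NormedAddCommGroup (α k i)] [∀ k i, InnerProductSpace ℝ (α k i)] [∀ k i, FiniteDimensional ℝ (α k i)]
  [∀ k i, MeasurableSpace (α k i)] [∀ k i, BorelSpace (α k i)]

open Classical in
/-- **THE μ-PART FOR N0w's CORES ON THE NESTED TORI OF THE PAPERS — GENERIC INNER DATA** (kernel; N0x PART 2's
`muPart_locE_le_of_coresAt_pencil_components` ONCE BY NAME at `D := tsys 4 N′`, `G := tgeometry 4 N′`, `Dk := tsys 4 (L·N′)`,
`Gk := tgeometry 4 (L·N′)`, with N0w's closure `cl := tclosureDom L N′`, the anchor CONSTRUCTED at the canonical cell of each member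
(S51 §1; `Aₐ := 3⁴·L⁴`), the (2.36)-KIND transfer `htransfer :=` pv22's `ineq236With_torus` (`ℓ = L∕a236 L`, `3 ≤ L`), N0v's
(2.27)∘(2.37)-KIND link `hlink := link_torus'` (`c′ = 5`) and the step letters located (N0o `torus_consts`, S24 `K₀_four`).  DISPLAYED:
the inner data `I`∕`m`∕`hm0` with the inner-count SHAPE `hinner` at free letters `c₀`∕`R₀`, (B1b)'s residue and `hadm`, (B3-amp) `hAmp`,
the located clauses; the source (`μ₁`, `μ₀`, `sμ`, `v`) enters ONLY `hH`, `hact`, `hAmp`.  For `0 < μ₀ < μ₁`, `‖sμ‖ ≤ μ₀`: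
`‖E[act sμ](X₀) − E[act 0](X₀)‖ ≤ e·9·64·K₀(64,8)²·A·e^{−r₁·d(X₀)}·μ₀∕(μ₁ − μ₀)` at the COARSE torus. [folklore] -/
theorem muPart_locE_le_of_coresAt_pencil_components_nestedTori (hL : 3 ≤ L) {Win : Set (ℕ → ℝ)}
    {ctr : ℕ → (ℕ → ℝ) → C.BgB → Op × B13HistM P} {ROp RHist R' : ℕ → ℝ}
    (𝔊 : ∀ k i, C.Dom → BiCore P (dom k i) Op (β k i) (α k i))
    {mq bq N₀ : ℕ → (Σ _ : Finset (TPt 4 N'), Σ F : Finset (tsys 4 N').Dom, ∀ Z ∈ F, (Σ _ : (tsys 4 (L * N')).Dom, ι₀)) →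
      C.Dom → ℝ}
    (hroom : ∀ k, ROp k < R' k)
    (hm : ∀ k, ∀ g ∈ Win, ∀ (U : C.BgB) (X : C.Dom), C.scale X = k → ∀ i, 0 < mq k i X)
    (hN : ∀ k, ∀ g ∈ Win, ∀ (U : C.BgB) (X : C.Dom), C.scale X = k → ∀ i,
      (∀ o ∈ ball (ctr k g U).1 (R' k), AEStronglyMeasurable ((𝔊 k i X).N o) (𝔊 k i X).lam) ∧
      (∀ p, DifferentiableOn ℂ (fun o => (𝔊 k i X).N o p) (ball (ctr k g U).1 (R' k))) ∧
      (∀ o ∈ ball (ctr k g U).1 (R' k), ∀ p, ‖(𝔊 k i X).N o p‖ ≤ N₀ k i X))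
    (hq : ∀ k, ∀ g ∈ Win, ∀ (U : C.BgB) (X : C.Dom), C.scale X = k → ∀ i,
      (∀ o ∈ ball (ctr k g U).1 (R' k),
        AEStronglyMeasurable (Function.uncurry ((𝔊 k i X).q o)) ((𝔊 k i X).lam.prod volume)) ∧
      (∀ p v, DifferentiableOn ℂ (fun o => (𝔊 k i X).q o p v) (ball (ctr k g U).1 (R' k))) ∧
      (∀ o ∈ ball (ctr k g U).1 (R' k), ∀ p v, mq k i X * ‖v‖ ^ 2 - bq k i X ≤ ((𝔊 k i X).q o p v).re))
    {k : ℕ} {g : ℕ → ℝ} (hg : g ∈ Win) {U : C.BgB} {o : Op} {h₀ v : B13HistM P} {μ₁ : ℝ}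
    (hO : ‖o - (ctr k g U).1‖ ≤ ROp k) (hH : ‖h₀ - (ctr k g U).2‖ + μ₁ * ‖v‖ ≤ RHist k)
    {emb : (tsys 4 N').Dom → C.Dom} (hscale : ∀ Z, C.scale (emb Z) = k)
    {terms : (tsys 4 N').Dom →
      Finset (Σ _ : Finset (TPt 4 N'), Σ F : Finset (tsys 4 N').Dom, ∀ Z ∈ F, (Σ _ : (tsys 4 (L * N')).Dom, ι₀))}
    {act : ℂ → (tsys 4 N').Dom → ℂ}
    (hact : ∀ σ ∈ ball (0 : ℂ) μ₁, ∀ Z, act σ Z = ∑ i ∈ terms Z, (𝔊 k i (emb Z)).termAt o (h₀ + σ • v))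
    {A Rkp r₁ μ₀ : ℝ} (X₀ : (tsys 4 N').Dom) {sμ : ℂ} (hA : 0 ≤ A) (hr₁ : 0 ≤ r₁)
    (hrate : r₁ + 2 * (64 * Real.log 162) + 2 ≤ Rkp) (hsmall : A * Real.exp (5 * r₁ + 1) * K₀ 64 8 * 9 * 64 ≤ 1)
    (I : (tsys 4 (L * N')).Dom → Finset ι₀) (m : (tsys 4 (L * N')).Dom → ι₀ → ℝ) (hm0 : ∀ Z₀ l, 0 ≤ m Z₀ l)
    {ε c₀ R₀ r R vW : ℝ} (hε : 0 ≤ ε) (hvW : 0 ≤ vW)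
    (hinner : ∀ Z₀ : (tsys 4 (L * N')).Dom, ∑ l ∈ I Z₀, m Z₀ l ≤ Real.exp c₀ * Real.exp (-(R₀ * torusTreeLen Z₀.1)))
    (hκR : 64 * Real.log 162 ≤ R₀) (hrate2 : r + R ≤ (R₀ - 64 * Real.log 162) * ((L : ℝ) / a236 L))
    (hκ : 64 * Real.log 162 + 1 ≤ r)
    (h229 : Real.exp 1 * K₀ 64 8 * 64 * (ε * Real.exp c₀ * ((3 : ℝ) ^ 4 * (L : ℝ) ^ 4) * K₀ 64 8 * Real.exp (5 * R)) ≤ 1)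
    (hRR : Rkp ≤ R - 64 * (vW * Real.exp (R * 5)))
    (hadm : ∀ Z : (tsys 4 N').Dom, ∀ l ∈ terms Z, l.1 ⊆ Z.1 ∧
      l.2.1 ∈ coveringFamilies Finset.univ (fun Y : (tsys 4 N').Dom => Y.1) (Z.1 \ l.1) ∧
      ∀ Z' (h : Z' ∈ l.2.1), l.2.2 Z' h ∈
        ((Finset.univ : Finset (tsys 4 (L * N')).Dom).filter (fun Z₀ => tclosureDom L N' Z₀ = Z')).sigma I)
    (hAmp : ∀ Z : (tsys 4 N').Dom, Z.1 ⊆ X₀.1 → ∀ l ∈ terms Z,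
      (𝔊 k l (emb Z)).lam.real univ * ((𝔊 k l (emb Z)).wB * N₀ k l (emb Z) * Real.exp (bq k l (emb Z))) *
          (Real.pi / (mq k l (emb Z) / 2)) ^ (Module.finrank ℝ (α k l) / 2 : ℝ) *
        Real.exp ((𝔊 k l (emb Z)).N₁ * (‖h₀‖ + μ₁ * ‖v‖)) ≤
      A * (vW ^ l.1.card * ∏ x ∈ l.2.1.attach, (ε * m (l.2.2 x.1 x.2).1 (l.2.2 x.1 x.2).2)))
    (h0 : 0 < μ₀) (h01 : μ₀ < μ₁) (hμ : ‖sμ‖ ≤ μ₀) :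
    ‖locE (TTouch (d := 4) (N := N')) (fun Z : (tsys 4 N').Dom => Z.1) (act sμ) X₀.1 -
        locE (TTouch (d := 4) (N := N')) (fun Z : (tsys 4 N').Dom => Z.1) (act 0) X₀.1‖ ≤
      Real.exp 1 * 9 * 64 * K₀ 64 8 ^ 2 * A * Real.exp (-(r₁ * torusTreeLen X₀.1)) * (μ₀ / (μ₁ - μ₀)) := by
  obtain ⟨hν, hκ₀, hc⟩ := torus_consts N'
  obtain ⟨-, hκ₀k, -⟩ := torus_consts (L * N')
  have hK₀ := K₀_four (N := N')
  have hK₀k := K₀_four (N := L * N')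
  have htr := ineq236With_torus (d := 4) L N' hL
  have h := muPart_locE_le_of_coresAt_pencil_components (tsys 4 N') (tgeometry 4 N') (tgeometry 4 (L * N')) 𝔊 hroom hm hN
    hq hg hO hH hscale hact (Rkp := Rkp) (b₅ := 5 * r₁) (X₀ := X₀) (sμ := sμ) hA hr₁ (le_of_eq (by ring))
    (by rw [hκ₀]; exact hrate) (by rw [hK₀, hν, hc]; exact hsmall) I m hm0 (tclosureDom L N')
    (fun Z' => Finset.univ.filter fun a : TPt 4 (L * N') =>
      ∃ y ∈ block (natLift a), proj N' (coarse L y) = Classical.choose Z'.2.1)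
    (c₀ := c₀) (R₀ := R₀) (Aₐ := (3 : ℝ) ^ 4 * (L : ℝ) ^ 4) (ℓ := (L : ℝ) / a236 L) (c' := 5) hε hvW hinner
    (fun Z₀ Z' h => by subst h; exact exists_mem_anchor_choose Z₀)
    (fun Z' => card_anchor_choose_le (d := 4) (L := L) Z')
    (fun Z₀ Z' h => by subst h; exact htr Z₀) (by rw [hκ₀k]; exact hκR) (by rw [hκ₀k]; exact hrate2)
    (by rw [hκ₀]; exact hκ) (by rw [hK₀, hc, hK₀k]; exact h229) (fun Z W hW F hF => link_torus' 4 N' Z W hW F hF)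
    (by rw [hc]; exact hRR) hadm hAmp h0 h01 hμ
  rw [hν, hc, hK₀] at h
  exact h

end Generic

/-! ## §2 ∕ §3 N0u's INNER LABELS (`hinner` SUPPLIED by S41.2 inside N0z): THE μ-TWINS OF S51's TWO ENDs -/

section Single

variable
  {𝒴 : ℕ → (Σ _ : Finset (TPt 4 N'), Σ F : Finset (tsys 4 N').Dom, ∀ Z ∈ F,
    (Σ _ : (tsys 4 (L * N')).Dom, (Σ _ : Finset (TPt 4 (L * N')), Finset (tsys 4 (L * N')).Dom × Finset Bnd))) → Type*}
  {dom : ∀ k i, 𝒴 k i → C.Dom}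
  {β : ℕ → (Σ _ : Finset (TPt 4 N'), Σ F : Finset (tsys 4 N').Dom, ∀ Z ∈ F,
    (Σ _ : (tsys 4 (L * N')).Dom, (Σ _ : Finset (TPt 4 (L * N')), Finset (tsys 4 (L * N')).Dom × Finset Bnd))) → Type*}
  [∀ k i, MeasurableSpace (β k i)]
  {α : ℕ → (Σ _ : Finset (TPt 4 N'), Σ F : Finset (tsys 4 N').Dom, ∀ Z ∈ F,
    (Σ _ : (tsys 4 (L * N')).Dom, (Σ _ : Finset (TPt 4 (L * N')), Finset (tsys 4 (L * N')).Dom × Finset Bnd))) → Type*}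
  [∀ k i, NormedAddCommGroup (α k i)] [∀ k i, InnerProductSpace ℝ (α k i)] [∀ k i, FiniteDimensional ℝ (α k i)]
  [∀ k i, MeasurableSpace (α k i)] [∀ k i, BorelSpace (α k i)]

open Classical in
/-- **THE μ-TWIN OF S51's FIRST END — THE WHOLE (B3-count) CHAIN ALONG THE SOURCE PENCIL ON THE NESTED TORI, ONE COMPONENT PER
MEMBER** (kernel; N0z §2 `muPart_locE_le_of_coresAt_pencil_components_inner` ONCE BY NAME at `D := tsys 4 N′`, `G := tgeometry 4 N′`,
`Dk := tsys 4 (L·N′)`, `Gk := tgeometry 4 (L·N′)` with EVERY geometric binder SUPPLIED exactly as in S51: N0u's (2.27)∘(2.32)-KIND link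
`hlinkk := link_torus 4 (L·N′)` (`c₃₂ = 5`), N0v's (2.27)∘(2.37)-KIND link `hlink := link_torus' 4 N′` (`c′ = 5`), N0w's closure
`cl := tclosureDom L N′`, the (2.36)-KIND transfer `htransfer := ineq236With_torus` (`ℓ = L∕a236 L`, `3 ≤ L`), the anchor at the
canonical cell (S51 §1, `Aₐ := 3⁴·L⁴`), `hinner` from N0u (inside N0z, by S41.2 §1), letters located at BOTH scales.  STILL
DISPLAYED: (B1b)'s residue and `hadm` (N0u's admissible labels WRITTEN OUT), `bondsOf`∕`hb₀`, `δ κ α₆ R_k b₀ s t`, `vW`, (B3-amp)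
`hAmp` along the source pencil, the located clauses and the rate bookkeeping ((B5)-KIND).  Binders = S51's single-component END's
VERBATIM under N0x P2's swap: MINUS [`w`, `ϱ`, `A₀`, `A₁`, `hA₀`, `hA₁`, `hϱ`, `hϱA`] PLUS [`v`, `μ₁`, `μ₀`, `sμ`, `A`, `hA`, `h0`,
`h01`, `hμ`], weight `v` ↦ `vW`. [folklore] -/
theorem muPart_locE_le_of_coresAt_pencil_components_inner_nestedTori (hL : 3 ≤ L) {Win : Set (ℕ → ℝ)}
    {ctr : ℕ → (ℕ → ℝ) → C.BgB → Op × B13HistM P} {ROp RHist R' : ℕ → ℝ}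
    (𝔊 : ∀ k i, C.Dom → BiCore P (dom k i) Op (β k i) (α k i))
    {mq bq N₀ : ℕ → (Σ _ : Finset (TPt 4 N'), Σ F : Finset (tsys 4 N').Dom, ∀ Z ∈ F,
      (Σ _ : (tsys 4 (L * N')).Dom, (Σ _ : Finset (TPt 4 (L * N')), Finset (tsys 4 (L * N')).Dom × Finset Bnd))) →
      C.Dom → ℝ}
    (hroom : ∀ k, ROp k < R' k)
    (hm : ∀ k, ∀ g ∈ Win, ∀ (U : C.BgB) (X : C.Dom), C.scale X = k → ∀ i, 0 < mq k i X)
    (hN : ∀ k, ∀ g ∈ Win, ∀ (U : C.BgB) (X : C.Dom), C.scale X = k → ∀ i,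
      (∀ o ∈ ball (ctr k g U).1 (R' k), AEStronglyMeasurable ((𝔊 k i X).N o) (𝔊 k i X).lam) ∧
      (∀ p, DifferentiableOn ℂ (fun o => (𝔊 k i X).N o p) (ball (ctr k g U).1 (R' k))) ∧
      (∀ o ∈ ball (ctr k g U).1 (R' k), ∀ p, ‖(𝔊 k i X).N o p‖ ≤ N₀ k i X))
    (hq : ∀ k, ∀ g ∈ Win, ∀ (U : C.BgB) (X : C.Dom), C.scale X = k → ∀ i,
      (∀ o ∈ ball (ctr k g U).1 (R' k),
        AEStronglyMeasurable (Function.uncurry ((𝔊 k i X).q o)) ((𝔊 k i X).lam.prod volume)) ∧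
      (∀ p v, DifferentiableOn ℂ (fun o => (𝔊 k i X).q o p v) (ball (ctr k g U).1 (R' k))) ∧
      (∀ o ∈ ball (ctr k g U).1 (R' k), ∀ p v, mq k i X * ‖v‖ ^ 2 - bq k i X ≤ ((𝔊 k i X).q o p v).re))
    {k : ℕ} {g : ℕ → ℝ} (hg : g ∈ Win) {U : C.BgB} {o : Op} {h₀ v : B13HistM P} {μ₁ : ℝ}
    (hO : ‖o - (ctr k g U).1‖ ≤ ROp k) (hH : ‖h₀ - (ctr k g U).2‖ + μ₁ * ‖v‖ ≤ RHist k)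
    {emb : (tsys 4 N').Dom → C.Dom} (hscale : ∀ Z, C.scale (emb Z) = k)
    {terms : (tsys 4 N').Dom → Finset (Σ _ : Finset (TPt 4 N'), Σ F : Finset (tsys 4 N').Dom, ∀ Z ∈ F,
      (Σ _ : (tsys 4 (L * N')).Dom, (Σ _ : Finset (TPt 4 (L * N')), Finset (tsys 4 (L * N')).Dom × Finset Bnd)))}
    {act : ℂ → (tsys 4 N').Dom → ℂ}
    (hact : ∀ σ ∈ ball (0 : ℂ) μ₁, ∀ Z, act σ Z = ∑ i ∈ terms Z, (𝔊 k i (emb Z)).termAt o (h₀ + σ • v))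
    {A Rkp r₁ μ₀ : ℝ} (X₀ : (tsys 4 N').Dom) {sμ : ℂ} (hA : 0 ≤ A) (hr₁ : 0 ≤ r₁)
    (hrate : r₁ + 2 * (64 * Real.log 162) + 2 ≤ Rkp) (hsmall : A * Real.exp (5 * r₁ + 1) * K₀ 64 8 * 9 * 64 ≤ 1)
    (bondsOf : Finset (TPt 4 (L * N')) → Finset Bnd) {δ κ α₆ Rk b₀ s t : ℝ}
    (hα₆ : 0 ≤ α₆) (hκk : 64 * Real.log 162 + 1 ≤ δ * κ) (h229k : Real.exp 1 * K₀ 64 8 * 64 * α₆ ≤ 1)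
    (hs0 : 0 ≤ s) (hs1 : s ≤ 1) (ht : 0 ≤ t) (hb₀ : ∀ W, ((bondsOf W).card : ℝ) ≤ b₀ * W.card)
    {ε r R vW : ℝ} (hε : 0 ≤ ε) (hvW : 0 ≤ vW)
    (hκR : 64 * Real.log 162 ≤ Rk - 64 * (Real.exp (Rk * 5) * s * Real.exp (b₀ * t)))
    (hrate2 : r + R ≤ (Rk - 64 * (Real.exp (Rk * 5) * s * Real.exp (b₀ * t)) - 64 * Real.log 162) * ((L : ℝ) / a236 L))
    (hκ : 64 * Real.log 162 + 1 ≤ r)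
    (h229 : Real.exp 1 * K₀ 64 8 * 64 *
      (ε * Real.exp (64 * (Real.exp (Rk * 5) * s * Real.exp (b₀ * t)) - 5 * Rk) * ((3 : ℝ) ^ 4 * (L : ℝ) ^ 4) * K₀ 64 8 *
        Real.exp (5 * R)) ≤ 1)
    (hRR : Rkp ≤ R - 64 * (vW * Real.exp (R * 5)))
    (hadm : ∀ Z : (tsys 4 N').Dom, ∀ l ∈ terms Z, l.1 ⊆ Z.1 ∧
      l.2.1 ∈ coveringFamilies Finset.univ (fun Y : (tsys 4 N').Dom => Y.1) (Z.1 \ l.1) ∧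
      ∀ Z' (h : Z' ∈ l.2.1), l.2.2 Z' h ∈
        ((Finset.univ : Finset (tsys 4 (L * N')).Dom).filter (fun Z₀ => tclosureDom L N' Z₀ = Z')).sigma fun Z₀ =>
          Z₀.1.powerset.sigma fun W =>
            coveringFamilies Finset.univ (fun Y : (tsys 4 (L * N')).Dom => Y.1) (Z₀.1 \ W) ×ˢ
              (bondsOf W).powerset.filter fun P => W.card ≤ 2 * P.card)
    (hAmp : ∀ Z : (tsys 4 N').Dom, Z.1 ⊆ X₀.1 → ∀ l ∈ terms Z,
      (𝔊 k l (emb Z)).lam.real univ * ((𝔊 k l (emb Z)).wB * N₀ k l (emb Z) * Real.exp (bq k l (emb Z))) *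
          (Real.pi / (mq k l (emb Z) / 2)) ^ (Module.finrank ℝ (α k l) / 2 : ℝ) *
        Real.exp ((𝔊 k l (emb Z)).N₁ * (‖h₀‖ + μ₁ * ‖v‖)) ≤
      A * (vW ^ l.1.card * ∏ x ∈ l.2.1.attach, (ε *
        ((∏ Y ∈ (l.2.2 x.1 x.2).2.2.1,
            (α₆ * Real.exp (-(δ * κ * torusTreeLen Y.1)) * Real.exp (-(Rk * (torusTreeLen Y.1 + 5))))) *
          (s ^ 2 * t) ^ (l.2.2 x.1 x.2).2.2.2.card))))
    (h0 : 0 < μ₀) (h01 : μ₀ < μ₁) (hμ : ‖sμ‖ ≤ μ₀) :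
    ‖locE (TTouch (d := 4) (N := N')) (fun Z : (tsys 4 N').Dom => Z.1) (act sμ) X₀.1 -
        locE (TTouch (d := 4) (N := N')) (fun Z : (tsys 4 N').Dom => Z.1) (act 0) X₀.1‖ ≤
      Real.exp 1 * 9 * 64 * K₀ 64 8 ^ 2 * A * Real.exp (-(r₁ * torusTreeLen X₀.1)) * (μ₀ / (μ₁ - μ₀)) := by
  obtain ⟨hν, hκ₀, hc⟩ := torus_consts N'
  obtain ⟨-, hκ₀k, hck⟩ := torus_consts (L * N')
  have hK₀ := K₀_four (N := N')
  have hK₀k := K₀_four (N := L * N')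
  have htr := ineq236With_torus (d := 4) L N' hL
  have h := muPart_locE_le_of_coresAt_pencil_components_inner (tsys 4 N') (tgeometry 4 N') (tgeometry 4 (L * N')) 𝔊 hroom
    hm hN hq hg hO hH hscale hact (Rkp := Rkp) (b₅ := 5 * r₁) (X₀ := X₀) (sμ := sμ) hA hr₁ (le_of_eq (by ring))
    (by rw [hκ₀]; exact hrate) (by rw [hK₀, hν, hc]; exact hsmall) bondsOf (c₃₂ := 5) hα₆ (by rw [hκ₀k]; exact hκk)
    (by rw [hK₀k, hck]; exact h229k) hs0 hs1 ht hb₀ (fun Z₀ W hW Df hDf => link_torus 4 (L * N') Z₀ W hW Df hDf)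
    (tclosureDom L N')
    (fun Z' => Finset.univ.filter fun a : TPt 4 (L * N') =>
      ∃ y ∈ block (natLift a), proj N' (coarse L y) = Classical.choose Z'.2.1)
    (Aₐ := (3 : ℝ) ^ 4 * (L : ℝ) ^ 4) (ℓ := (L : ℝ) / a236 L) (c' := 5) hε hvW
    (fun Z₀ Z' h => by subst h; exact exists_mem_anchor_choose Z₀)
    (fun Z' => card_anchor_choose_le (d := 4) (L := L) Z')
    (fun Z₀ Z' h => by subst h; exact htr Z₀) (by rw [hκ₀k, hck]; exact hκR) (by rw [hκ₀k, hck]; exact hrate2)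
    (by rw [hκ₀]; exact hκ) (by rw [hK₀, hc, hK₀k, hck]; exact h229) (fun Z W hW F hF => link_torus' 4 N' Z W hW F hF)
    (by rw [hc]; exact hRR) hadm hAmp h0 h01 hμ
  rw [hν, hc, hK₀] at h
  exact h

end Single

section Sets

variable
  {𝒴 : ℕ → (Σ _ : Finset (TPt 4 N'), Σ F : Finset (tsys 4 N').Dom, ∀ Z ∈ F,
    Finset (Σ _ : (tsys 4 (L * N')).Dom, (Σ _ : Finset (TPt 4 (L * N')), Finset (tsys 4 (L * N')).Dom × Finset Bnd))) →
    Type*}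
  {dom : ∀ k i, 𝒴 k i → C.Dom}
  {β : ℕ → (Σ _ : Finset (TPt 4 N'), Σ F : Finset (tsys 4 N').Dom, ∀ Z ∈ F,
    Finset (Σ _ : (tsys 4 (L * N')).Dom, (Σ _ : Finset (TPt 4 (L * N')), Finset (tsys 4 (L * N')).Dom × Finset Bnd))) →
    Type*}
  [∀ k i, MeasurableSpace (β k i)]
  {α : ℕ → (Σ _ : Finset (TPt 4 N'), Σ F : Finset (tsys 4 N').Dom, ∀ Z ∈ F,
    Finset (Σ _ : (tsys 4 (L * N')).Dom, (Σ _ : Finset (TPt 4 (L * N')), Finset (tsys 4 (L * N')).Dom × Finset Bnd))) →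
    Type*}
  [∀ k i, NormedAddCommGroup (α k i)] [∀ k i, InnerProductSpace ℝ (α k i)] [∀ k i, FiniteDimensional ℝ (α k i)]
  [∀ k i, MeasurableSpace (α k i)] [∀ k i, BorelSpace (α k i)]

open Classical in
/-- **THE μ-TWIN OF S51's SECOND END — A NONEMPTY SET OF COMPONENTS PER MEMBER** (kernel; print p. 19's n ≥ 1 components determining
`Z′_i`: N0z §3 `muPart_locE_le_of_coresAt_pencil_componentSets_inner` ONCE BY NAME on the nested tori with the SAME supplies as
`muPart_locE_le_of_coresAt_pencil_components_inner_nestedTori` (both links at `5`, closure `tclosureDom`, transfer `ineq236With_torus`,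
anchor at the canonical cell, `hinner` from N0u, letters at both scales located).  DISPLAYED as there, with `hadm`'s NONEMPTY-SUBSET
clause, `hAmp`'s set-product majorant along the source pencil and N0v's (2.29) clause `h229` at the amplitude `A·e^{5R}·e^{A}`,
`A := ε·e^{64u_k − 5R_k}·3⁴L⁴·K₀(64,8)`, `u_k := e^{5R_k}·s·e^{b₀t}`. [folklore] -/
theorem muPart_locE_le_of_coresAt_pencil_componentSets_inner_nestedTori (hL : 3 ≤ L) {Win : Set (ℕ → ℝ)}
    {ctr : ℕ → (ℕ → ℝ) → C.BgB → Op × B13HistM P} {ROp RHist R' : ℕ → ℝ}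
    (𝔊 : ∀ k i, C.Dom → BiCore P (dom k i) Op (β k i) (α k i))
    {mq bq N₀ : ℕ → (Σ _ : Finset (TPt 4 N'), Σ F : Finset (tsys 4 N').Dom, ∀ Z ∈ F,
      Finset (Σ _ : (tsys 4 (L * N')).Dom, (Σ _ : Finset (TPt 4 (L * N')), Finset (tsys 4 (L * N')).Dom × Finset Bnd))) →
      C.Dom → ℝ}
    (hroom : ∀ k, ROp k < R' k)
    (hm : ∀ k, ∀ g ∈ Win, ∀ (U : C.BgB) (X : C.Dom), C.scale X = k → ∀ i, 0 < mq k i X)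
    (hN : ∀ k, ∀ g ∈ Win, ∀ (U : C.BgB) (X : C.Dom), C.scale X = k → ∀ i,
      (∀ o ∈ ball (ctr k g U).1 (R' k), AEStronglyMeasurable ((𝔊 k i X).N o) (𝔊 k i X).lam) ∧
      (∀ p, DifferentiableOn ℂ (fun o => (𝔊 k i X).N o p) (ball (ctr k g U).1 (R' k))) ∧
      (∀ o ∈ ball (ctr k g U).1 (R' k), ∀ p, ‖(𝔊 k i X).N o p‖ ≤ N₀ k i X))
    (hq : ∀ k, ∀ g ∈ Win, ∀ (U : C.BgB) (X : C.Dom), C.scale X = k → ∀ i,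
      (∀ o ∈ ball (ctr k g U).1 (R' k),
        AEStronglyMeasurable (Function.uncurry ((𝔊 k i X).q o)) ((𝔊 k i X).lam.prod volume)) ∧
      (∀ p v, DifferentiableOn ℂ (fun o => (𝔊 k i X).q o p v) (ball (ctr k g U).1 (R' k))) ∧
      (∀ o ∈ ball (ctr k g U).1 (R' k), ∀ p v, mq k i X * ‖v‖ ^ 2 - bq k i X ≤ ((𝔊 k i X).q o p v).re))
    {k : ℕ} {g : ℕ → ℝ} (hg : g ∈ Win) {U : C.BgB} {o : Op} {h₀ v : B13HistM P} {μ₁ : ℝ}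
    (hO : ‖o - (ctr k g U).1‖ ≤ ROp k) (hH : ‖h₀ - (ctr k g U).2‖ + μ₁ * ‖v‖ ≤ RHist k)
    {emb : (tsys 4 N').Dom → C.Dom} (hscale : ∀ Z, C.scale (emb Z) = k)
    {terms : (tsys 4 N').Dom → Finset (Σ _ : Finset (TPt 4 N'), Σ F : Finset (tsys 4 N').Dom, ∀ Z ∈ F,
      Finset (Σ _ : (tsys 4 (L * N')).Dom, (Σ _ : Finset (TPt 4 (L * N')), Finset (tsys 4 (L * N')).Dom × Finset Bnd)))}
    {act : ℂ → (tsys 4 N').Dom → ℂ}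
    (hact : ∀ σ ∈ ball (0 : ℂ) μ₁, ∀ Z, act σ Z = ∑ i ∈ terms Z, (𝔊 k i (emb Z)).termAt o (h₀ + σ • v))
    {A Rkp r₁ μ₀ : ℝ} (X₀ : (tsys 4 N').Dom) {sμ : ℂ} (hA : 0 ≤ A) (hr₁ : 0 ≤ r₁)
    (hrate : r₁ + 2 * (64 * Real.log 162) + 2 ≤ Rkp) (hsmall : A * Real.exp (5 * r₁ + 1) * K₀ 64 8 * 9 * 64 ≤ 1)
    (bondsOf : Finset (TPt 4 (L * N')) → Finset Bnd) {δ κ α₆ Rk b₀ s t : ℝ}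
    (hα₆ : 0 ≤ α₆) (hκk : 64 * Real.log 162 + 1 ≤ δ * κ) (h229k : Real.exp 1 * K₀ 64 8 * 64 * α₆ ≤ 1)
    (hs0 : 0 ≤ s) (hs1 : s ≤ 1) (ht : 0 ≤ t) (hb₀ : ∀ W, ((bondsOf W).card : ℝ) ≤ b₀ * W.card)
    {ε r R vW : ℝ} (hε : 0 ≤ ε) (hvW : 0 ≤ vW)
    (hκR : 64 * Real.log 162 ≤ Rk - 64 * (Real.exp (Rk * 5) * s * Real.exp (b₀ * t)))
    (hrate2 : r + R ≤ (Rk - 64 * (Real.exp (Rk * 5) * s * Real.exp (b₀ * t)) - 64 * Real.log 162) * ((L : ℝ) / a236 L))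
    (hκ : 64 * Real.log 162 + 1 ≤ r)
    (h229 : Real.exp 1 * K₀ 64 8 * 64 *
      (ε * Real.exp (64 * (Real.exp (Rk * 5) * s * Real.exp (b₀ * t)) - 5 * Rk) * ((3 : ℝ) ^ 4 * (L : ℝ) ^ 4) * K₀ 64 8 *
          Real.exp (5 * R) *
        Real.exp (ε * Real.exp (64 * (Real.exp (Rk * 5) * s * Real.exp (b₀ * t)) - 5 * Rk) * ((3 : ℝ) ^ 4 * (L : ℝ) ^ 4) *
          K₀ 64 8)) ≤ 1)
    (hRR : Rkp ≤ R - 64 * (vW * Real.exp (R * 5)))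
    (hadm : ∀ Z : (tsys 4 N').Dom, ∀ l ∈ terms Z, l.1 ⊆ Z.1 ∧
      l.2.1 ∈ coveringFamilies Finset.univ (fun Y : (tsys 4 N').Dom => Y.1) (Z.1 \ l.1) ∧
      ∀ Z' (h : Z' ∈ l.2.1), (l.2.2 Z' h).Nonempty ∧
        l.2.2 Z' h ⊆
          ((Finset.univ : Finset (tsys 4 (L * N')).Dom).filter (fun Z₀ => tclosureDom L N' Z₀ = Z')).sigma fun Z₀ =>
            Z₀.1.powerset.sigma fun W =>
              coveringFamilies Finset.univ (fun Y : (tsys 4 (L * N')).Dom => Y.1) (Z₀.1 \ W) ×ˢ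
                (bondsOf W).powerset.filter fun P => W.card ≤ 2 * P.card)
    (hAmp : ∀ Z : (tsys 4 N').Dom, Z.1 ⊆ X₀.1 → ∀ l ∈ terms Z,
      (𝔊 k l (emb Z)).lam.real univ * ((𝔊 k l (emb Z)).wB * N₀ k l (emb Z) * Real.exp (bq k l (emb Z))) *
          (Real.pi / (mq k l (emb Z) / 2)) ^ (Module.finrank ℝ (α k l) / 2 : ℝ) *
        Real.exp ((𝔊 k l (emb Z)).N₁ * (‖h₀‖ + μ₁ * ‖v‖)) ≤
      A * (vW ^ l.1.card * ∏ x ∈ l.2.1.attach, ∏ j ∈ l.2.2 x.1 x.2, (ε *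
        ((∏ Y ∈ j.2.2.1, (α₆ * Real.exp (-(δ * κ * torusTreeLen Y.1)) * Real.exp (-(Rk * (torusTreeLen Y.1 + 5))))) *
          (s ^ 2 * t) ^ j.2.2.2.card))))
    (h0 : 0 < μ₀) (h01 : μ₀ < μ₁) (hμ : ‖sμ‖ ≤ μ₀) :
    ‖locE (TTouch (d := 4) (N := N')) (fun Z : (tsys 4 N').Dom => Z.1) (act sμ) X₀.1 -
        locE (TTouch (d := 4) (N := N')) (fun Z : (tsys 4 N').Dom => Z.1) (act 0) X₀.1‖ ≤
      Real.exp 1 * 9 * 64 * K₀ 64 8 ^ 2 * A * Real.exp (-(r₁ * torusTreeLen X₀.1)) * (μ₀ / (μ₁ - μ₀)) := by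
  obtain ⟨hν, hκ₀, hc⟩ := torus_consts N'
  obtain ⟨-, hκ₀k, hck⟩ := torus_consts (L * N')
  have hK₀ := K₀_four (N := N')
  have hK₀k := K₀_four (N := L * N')
  have htr := ineq236With_torus (d := 4) L N' hL
  have h := muPart_locE_le_of_coresAt_pencil_componentSets_inner (tsys 4 N') (tgeometry 4 N') (tgeometry 4 (L * N')) 𝔊 hroom
    hm hN hq hg hO hH hscale hact (Rkp := Rkp) (b₅ := 5 * r₁) (X₀ := X₀) (sμ := sμ) hA hr₁ (le_of_eq (by ring))
    (by rw [hκ₀]; exact hrate) (by rw [hK₀, hν, hc]; exact hsmall) bondsOf (c₃₂ := 5) hα₆ (by rw [hκ₀k]; exact hκk)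
    (by rw [hK₀k, hck]; exact h229k) hs0 hs1 ht hb₀ (fun Z₀ W hW Df hDf => link_torus 4 (L * N') Z₀ W hW Df hDf)
    (tclosureDom L N')
    (fun Z' => Finset.univ.filter fun a : TPt 4 (L * N') =>
      ∃ y ∈ block (natLift a), proj N' (coarse L y) = Classical.choose Z'.2.1)
    (Aₐ := (3 : ℝ) ^ 4 * (L : ℝ) ^ 4) (ℓ := (L : ℝ) / a236 L) (c' := 5) hε hvW
    (fun Z₀ Z' h => by subst h; exact exists_mem_anchor_choose Z₀)
    (fun Z' => card_anchor_choose_le (d := 4) (L := L) Z')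
    (fun Z₀ Z' h => by subst h; exact htr Z₀) (by rw [hκ₀k, hck]; exact hκR) (by rw [hκ₀k, hck]; exact hrate2)
    (by rw [hκ₀]; exact hκ) (by rw [hK₀, hc, hK₀k, hck]; exact h229) (fun Z W hW F hF => link_torus' 4 N' Z W hW F hF)
    (by rw [hc]; exact hRR) hadm hAmp h0 h01 hμ
  rw [hν, hc, hK₀] at h
  exact h

end Sets

end Summit.QuantumFields.BalabanUV.T4Continuum.NE1p.DressedSmallFieldComponentInnerMuNestedTori

end
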